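import Summits.MatrixMultiplication.MatrixMultiplication.Theorems.OutsiderSandwichExchangeLevelTwo
import Summits.MatrixMultiplication.MatrixMultiplication.Theorems.OutsiderSandwichBlockOneRank
import HarnessLib

/-!
# The delay ladder: extra FACTORS of the block instead of extra COPIES

Route `OutsiderSandwich` (decomposition cell `decomp-mm`, lens 4 «minimal counterexample /
extremal reduction», gen 26), support for the aside leaf `BlockOneIsMM`
(stmt-MatrixMultiplication-27147, `⟺ θ⋆ = 0`); the cut of record `closes(LaserTangency,
LaserMergeOptimal, SummitIffLaserTangency)` is untouched.

## The helper-free currency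

The exchange calculus of g20–g25 measures the leaf by HELP COUNTS
`Helped N B : ⟨B⟩ ⊠ C₁^{⊠N} ⊵ ⟨2,2,2⟩^{⊠N}` (`C₁ = coupling₁ ≅ pairTensor 2`).  The extremal reading
of the twist-gluing normal form (`OutsiderSandwichTwistGluing`: `C₁^{⊠N}` = one matrix read through
all `2^N` partial transposes) suggests paying with the block itself: since `⟨2⟩ ≤ C₁`
(`two_le_mk_coupling₁`), a copy can always be bought with a factor, and a **delay certificate**

  `Delayed N p : C₁^{⊠(N+p)} ⊵ ⟨2,2,2⟩^{⊠N}`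

is a LITERAL restriction between two Kronecker powers — no auxiliary unit tensor, no direct sum.
This file proves the dictionary and the first rungs:

* `delayed_of_helped` / `helped_of_delayed` — copies ↔ factors: `Helped N B`, `B ≤ 2^p` gives
  `Delayed N p`, and `Delayed N p` gives `Helped N (7^p)` (`R(C₁) ≤ 7`, `OutsiderSandwichBlockOneRank`).
* `blockOneIsMM_iff_sublinearDelay` — **`BlockOneIsMM ⟺` cofinally in `N` some `p ≤ εN` is a
  delay, for every `ε > 0`**: the leaf is the statement that matrix multiplication is recovered from
  a power of the bare block with SUBLINEARLY MANY extra factors; `ω = 2` implies it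
  (`sublinearDelay_of_summit`).
* the **delay numbers** `d(N) = min {p | Delayed N p}`: `1 ≤ d(N) ≤ ⌈N/2⌉` (`N ≥ 1`), `d` is
  subadditive, `d(1) = d(2) = 1`, `d(3) ∈ {1, 2}`; the first undecided rung is
  **`Delayed 3 1 : C₁^{⊠4} ⊵ ⟨8,8,8⟩`** (format `256³ → 64³`), implied by the open help rung
  `Helped 3 2` (`delayed_three_one_of_helped`) — a value-free instrument target.
* `exchangeExponent_le_of_delayed` — every delay certificate bounds the exchange exponent:
  `θ⋆ ≤ 3p/N`.

All statements are kernel-checked and sorry-free; `Delayed`, `delayNumber` are problem-side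
definitions of this file.

## References

* V. Strassen, *The asymptotic spectrum of tensors*, J. reine angew. Math. 384 (1988), Thm. 3.8
  (asymptotic restriction and the spectrum). [Strassen1988]
* J. Zuiddam, *Algebraic complexity, asymptotic spectra and entanglement polytopes*, PhD thesis
  (2018), §2.3 (the semiring `T(K)` and its Strassen preorder). [Zuiddam2018]
* M. Christandl, P. Vrana, J. Zuiddam, *Universal points in the asymptotic spectrum of tensors*,
  J. AMS 36 (2023), §1.1–1.2. [ChristandlVranaZuiddam2023]
* M. Bläser, *Fast Matrix Multiplication*, Theory of Computing Graduate Surveys 5 (2013), §5–7.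
  [Blaser2013]
-/

noncomputable section

set_option linter.dupNamespace false
set_option autoImplicit false

namespace Summit.MatrixMultiplication.MatrixMultiplication.Theorems.OutsiderSandwichDelayLadder

open Literature.Computability.AlgebraicComplexity
open Summit.MatrixMultiplication.MatrixMultiplication.Theorems.OutsiderSandwichCoupling (coupling₁)
open Summit.MatrixMultiplication.MatrixMultiplication.Theorems.OutsiderSandwichBlockNormalForm
  (pairTensor pairTensor_restrictsTo_coupling₁ coupling₁_restrictsTo_pairTensor)
open Summit.MatrixMultiplication.MatrixMultiplication.Theorems.OutsiderSandwichExchangeRate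
open Summit.MatrixMultiplication.MatrixMultiplication.Theorems.OutsiderSandwichExchangeExponent
open Summit.MatrixMultiplication.MatrixMultiplication.Theorems.OutsiderSandwichExchangeLevelTwo
open Summit.MatrixMultiplication.MatrixMultiplication.Theorems.OutsiderSandwichBlockOneRank
  (tensorRank_coupling₁_le)

/-! ## 1. Delay certificates and the block's place in `T(ℂ)` -/

/-- **`Delayed N p`**: `C₁^{⊠(N+p)} ⊵ ⟨2,2,2⟩^{⊠N}` — `p` extra FACTORS of the coupled block restore
`N`-fold `2 × 2` matrix multiplication (a literal restriction of Kronecker powers). -/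
def Delayed (N p : ℕ) : Prop :=
  TensorRestrictsTo (kroneckerPow coupling₁ (N + p)) (kroneckerPow (matMulTensor ℂ 2 2 2) N)

/-- `Delayed N p ⟺ [⟨2,2,2⟩]^N ≤ [C₁]^{N+p}` in `T(ℂ)`. -/
theorem delayed_iff_le (N p : ℕ) :
    Delayed N p ↔
      TensorClass.mk (matMulTensor ℂ 2 2 2) ^ N ≤ TensorClass.mk coupling₁ ^ (N + p) := by
  unfold Delayed
  rw [TensorClass.mk_pow, TensorClass.mk_pow, TensorClass.mk_le_mk_iff]

/-- `⟨2⟩` is the restriction of `pairTensor 2` to `A` diagonal, `u`-inputs, `Au`-outputs. -/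
theorem unitTensor_two_eq_pairTensor_comp :
    unitTensor ℂ 2 = fun i j k => pairTensor 2 (i, i) (0, j) (1, k) := by
  funext i j k
  simp only [unitTensor_apply, pairTensor]
  refine if_congr ?_ rfl rfl
  revert i j k
  decide

/-- `C₁ ⊵ ⟨2⟩`. -/
theorem coupling₁_restrictsTo_unitTensor_two : TensorRestrictsTo coupling₁ (unitTensor ℂ 2) := by
  have h : TensorRestrictsTo (pairTensor 2) (unitTensor ℂ 2) := by
    rw [unitTensor_two_eq_pairTensor_comp]
    exact tensorRestrictsTo_precomp (pairTensor 2) (fun i : Fin 2 => (i, i))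
      (fun j : Fin 2 => ((0 : Fin 2), j)) (fun k : Fin 2 => ((1 : Fin 2), k))
  exact coupling₁_restrictsTo_pairTensor.trans h

/-- **`2 ≤ [C₁]`** in `T(ℂ)`: a copy can be bought with a factor. -/
theorem two_le_mk_coupling₁ : ((2 : ℕ) : TensorClass ℂ) ≤ TensorClass.mk coupling₁ := by
  rw [TensorClass.natCast_eq_mk, TensorClass.mk_le_mk_iff]
  exact coupling₁_restrictsTo_unitTensor_two

/-- `1 ≤ [C₁]`. -/
theorem one_le_mk_coupling₁ : (1 : TensorClass ℂ) ≤ TensorClass.mk coupling₁ := by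
  have h : ((1 : ℕ) : TensorClass ℂ) ≤ ((2 : ℕ) : TensorClass ℂ) :=
    TensorClass.natCast_le_natCast_iff.2 (by norm_num)
  rw [Nat.cast_one] at h
  exact h.trans two_le_mk_coupling₁

/-- **`[C₁] ≤ 7`** in `T(ℂ)` (`R(C₁) ≤ 7`). -/
theorem mk_coupling₁_le_seven : TensorClass.mk coupling₁ ≤ ((7 : ℕ) : TensorClass ℂ) :=
  (TensorClass.mk_le_natCast_tensorRank coupling₁).trans
    (TensorClass.natCast_le_natCast_iff.2 tensorRank_coupling₁_le)

/-- Powers are monotone in `T(ℂ)` (Strassen preorder). -/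
theorem pow_mono {x y : TensorClass ℂ} (h : x ≤ y) (n : ℕ) : x ^ n ≤ y ^ n :=
  (TensorClass.isStrassenPreorder ℂ).pow_le_pow h n

/-- `1 ≤ [C₁]^n`. -/
theorem one_le_mk_coupling₁_pow (n : ℕ) : (1 : TensorClass ℂ) ≤ TensorClass.mk coupling₁ ^ n := by
  simpa using pow_mono one_le_mk_coupling₁ n

/-! ## 2. Copies ↔ factors -/

/-- **Copies → factors**: `B ≤ 2^p` helping copies can be replaced by `p` extra factors. -/
theorem delayed_of_helped {N B p : ℕ} (h : Helped N B) (hB : B ≤ 2 ^ p) : Delayed N p := by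
  rw [delayed_iff_le]
  rw [helped_iff_le] at h
  calc TensorClass.mk (matMulTensor ℂ 2 2 2) ^ N
      ≤ (B : TensorClass ℂ) * TensorClass.mk coupling₁ ^ N := h
    _ ≤ ((2 ^ p : ℕ) : TensorClass ℂ) * TensorClass.mk coupling₁ ^ N :=
        TensorClass.mul_le_mul (TensorClass.natCast_le_natCast_iff.2 hB) le_rfl
    _ = ((2 : ℕ) : TensorClass ℂ) ^ p * TensorClass.mk coupling₁ ^ N := by rw [Nat.cast_pow]
    _ ≤ TensorClass.mk coupling₁ ^ p * TensorClass.mk coupling₁ ^ N :=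
        TensorClass.mul_le_mul (pow_mono two_le_mk_coupling₁ p) le_rfl
    _ = TensorClass.mk coupling₁ ^ (N + p) := by rw [← pow_add, add_comm]

/-- **Factors → copies**: `p` extra factors are worth at most `7^p` copies. -/
theorem helped_of_delayed {N p : ℕ} (h : Delayed N p) : Helped N (7 ^ p) := by
  rw [helped_iff_le]
  rw [delayed_iff_le] at h
  calc TensorClass.mk (matMulTensor ℂ 2 2 2) ^ N ≤ TensorClass.mk coupling₁ ^ (N + p) := h
    _ = TensorClass.mk coupling₁ ^ p * TensorClass.mk coupling₁ ^ N := by rw [pow_add, mul_comm]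
    _ ≤ ((7 : ℕ) : TensorClass ℂ) ^ p * TensorClass.mk coupling₁ ^ N :=
        TensorClass.mul_le_mul (pow_mono mk_coupling₁_le_seven p) le_rfl
    _ = ((7 ^ p : ℕ) : TensorClass ℂ) * TensorClass.mk coupling₁ ^ N := by rw [Nat.cast_pow]

/-- `8^p` copies as well (the form used for rates: `8^p = 2^{3p}`). -/
theorem helped_eight_pow_of_delayed {N p : ℕ} (h : Delayed N p) : Helped N (8 ^ p) :=
  helped_mono (helped_of_delayed h) (Nat.pow_le_pow_left (by norm_num) p)

/-- More delay is still a delay. -/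
theorem delayed_mono {N p q : ℕ} (h : Delayed N p) (hpq : p ≤ q) : Delayed N q := by
  rw [delayed_iff_le] at h ⊢
  refine h.trans ?_
  calc TensorClass.mk coupling₁ ^ (N + p) = TensorClass.mk coupling₁ ^ (N + p) * 1 := (mul_one _).symm
    _ ≤ TensorClass.mk coupling₁ ^ (N + p) * TensorClass.mk coupling₁ ^ (q - p) :=
        TensorClass.mul_le_mul le_rfl (one_le_mk_coupling₁_pow _)
    _ = TensorClass.mk coupling₁ ^ (N + q) := by
        rw [← pow_add]; congr 1; omega

/-- **Delays add** (Kronecker products of certificates). -/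
theorem delayed_add {M N p q : ℕ} (h : Delayed M p) (h' : Delayed N q) :
    Delayed (M + N) (p + q) := by
  rw [delayed_iff_le] at h h' ⊢
  calc TensorClass.mk (matMulTensor ℂ 2 2 2) ^ (M + N)
      = TensorClass.mk (matMulTensor ℂ 2 2 2) ^ M * TensorClass.mk (matMulTensor ℂ 2 2 2) ^ N :=
        pow_add _ _ _
    _ ≤ TensorClass.mk coupling₁ ^ (M + p) * TensorClass.mk coupling₁ ^ (N + q) :=
        TensorClass.mul_le_mul h h'
    _ = TensorClass.mk coupling₁ ^ (M + N + (p + q)) := by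
        rw [← pow_add]; congr 1; omega

/-! ## 3. The rungs -/

/-- **No delay is never enough** (`N ≥ 1`): `C₁^{⊠N} ⋭ ⟨2,2,2⟩^{⊠N}` (one copy never helps). -/
theorem not_delayed_zero {N : ℕ} (hN : 1 ≤ N) : ¬ Delayed N 0 := fun h =>
  not_helped_one hN (by simpa using helped_of_delayed h)

/-- **Rung `d(1) ≤ 1`**: `C₁^{⊠2} ⊵ ⟨2,2,2⟩` (from `⟨2⟩ ⊠ C₁ ⊵ ⟨2,2,2⟩` and `C₁ ⊵ ⟨2⟩`). -/
theorem delayed_one_one : Delayed 1 1 :=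
  delayed_of_helped helped_one_two (by norm_num)

/-- **Rung `d(2) ≤ 1`**: `C₁^{⊠3} ⊵ ⟨4,4,4⟩` (from lens 2's symmetric cover `⟨2⟩ ⊠ C₁^{⊠2} ⊵ ⟨4,4,4⟩`). -/
theorem delayed_two_one : Delayed 2 1 :=
  delayed_of_helped helped_two_two (by norm_num)

/-- `C₁^{⊠3q} ⊵ ⟨2,2,2⟩^{⊠2q}`: delay rate `1/2` along even levels. -/
theorem delayed_two_mul (q : ℕ) : Delayed (2 * q) q :=
  delayed_of_helped (helped_two_mul q) le_rfl

/-- `Delayed N ⌈N/2⌉` for every `N` (via `r(N) ≤ 2^{⌈N/2⌉}`). -/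
theorem delayed_half (N : ℕ) : Delayed N ((N + 1) / 2) :=
  delayed_of_helped (helped_exchangeNumber N) (exchangeNumber_le_two_pow_half N)

/-- The open help rung `Helped 3 2` would give the delay rung `Delayed 3 1 : C₁^{⊠4} ⊵ ⟨8,8,8⟩`. -/
theorem delayed_three_one_of_helped (h : Helped 3 2) : Delayed 3 1 :=
  delayed_of_helped h (by norm_num)

/-! ## 4. Delay numbers -/

/-- **The delay number `d(N)`**: the least `p` with `C₁^{⊠(N+p)} ⊵ ⟨2,2,2⟩^{⊠N}`. -/
def delayNumber (N : ℕ) : ℕ := sInf {p | Delayed N p}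

/-- `d(N)` is attained. -/
theorem delayed_delayNumber (N : ℕ) : Delayed N (delayNumber N) :=
  Nat.sInf_mem (⟨(N + 1) / 2, delayed_half N⟩ : Set.Nonempty {p | Delayed N p})

/-- `d(N)` is least. -/
theorem delayNumber_le {N p : ℕ} (h : Delayed N p) : delayNumber N ≤ p :=
  Nat.sInf_le h

/-- `Delayed N p ⟺ d(N) ≤ p`. -/
theorem delayed_iff_delayNumber_le {N p : ℕ} : Delayed N p ↔ delayNumber N ≤ p :=
  ⟨delayNumber_le, fun h => delayed_mono (delayed_delayNumber N) h⟩

/-- `d(N) ≤ ⌈N/2⌉`. -/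
theorem delayNumber_le_half (N : ℕ) : delayNumber N ≤ (N + 1) / 2 :=
  delayNumber_le (delayed_half N)

/-- `1 ≤ d(N)` for `N ≥ 1`. -/
theorem one_le_delayNumber {N : ℕ} (hN : 1 ≤ N) : 1 ≤ delayNumber N := by
  by_contra h
  have h0 : delayNumber N = 0 := by omega
  exact not_delayed_zero hN (h0 ▸ delayed_delayNumber N)

/-- **`d` is subadditive.** -/
theorem delayNumber_add_le (M N : ℕ) : delayNumber (M + N) ≤ delayNumber M + delayNumber N :=
  delayNumber_le (delayed_add (delayed_delayNumber M) (delayed_delayNumber N))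

/-- **`d(1) = 1`.** -/
theorem delayNumber_one : delayNumber 1 = 1 :=
  le_antisymm (delayNumber_le delayed_one_one) (one_le_delayNumber le_rfl)

/-- **`d(2) = 1`.** -/
theorem delayNumber_two : delayNumber 2 = 1 :=
  le_antisymm (delayNumber_le delayed_two_one) (one_le_delayNumber (by norm_num))

/-- **`d(3) ∈ {1, 2}`** — the first undecided delay rung is `Delayed 3 1 : C₁^{⊠4} ⊵ ⟨8,8,8⟩`. -/
theorem delayNumber_three : delayNumber 3 = 1 ∨ delayNumber 3 = 2 := by
  have h1 : 1 ≤ delayNumber 3 := one_le_delayNumber (by norm_num)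
  have h2 : delayNumber 3 ≤ 2 := delayNumber_le_half 3
  omega

/-- `d(3) = 1 ⟺ Delayed 3 1`. -/
theorem delayNumber_three_eq_one_iff : delayNumber 3 = 1 ↔ Delayed 3 1 := by
  rw [delayed_iff_delayNumber_le]
  have h1 : 1 ≤ delayNumber 3 := one_le_delayNumber (by norm_num)
  omega

/-! ## 5. Rates and the leaf -/

/-- `8^p = 2^{3p}` as a real power. -/
theorem cast_eight_pow (p : ℕ) : ((8 ^ p : ℕ) : ℝ) = (2 : ℝ) ^ ((3 * p : ℕ) : ℝ) := by
  rw [Real.rpow_natCast]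
  push_cast
  rw [pow_mul]
  norm_num

/-- **A delay certificate achieves the rate `3p/N`.** -/
theorem exponentAchieved_of_delayed {N p : ℕ} (hN : 1 ≤ N) (h : Delayed N p) :
    ExponentAchieved (3 * (p : ℝ) / N) := by
  refine exponentAchieved_of_helped hN (helped_eight_pow_of_delayed h) (le_of_eq ?_)
  have hN' : (N : ℝ) ≠ 0 := by exact_mod_cast (show N ≠ 0 by omega)
  rw [div_mul_cancel₀ _ hN', cast_eight_pow]
  push_cast
  ring_nf

/-- **`θ⋆ ≤ 3 d / N`** for every delay certificate `Delayed N d` (`N ≥ 1`). -/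
theorem exchangeExponent_le_of_delayed {N p : ℕ} (hN : 1 ≤ N) (h : Delayed N p) :
    exchangeExponent ≤ 3 * (p : ℝ) / N :=
  exchangeExponent_le (exponentAchieved_of_delayed hN h)

/-- **THE LEAF IN DELAY CURRENCY: `BlockOneIsMM ⟺ sublinear delay`** — for every `ε > 0`, cofinally
in `N`, `C₁^{⊠(N+p)} ⊵ ⟨2,2,2⟩^{⊠N}` for some `p ≤ εN`. -/
theorem blockOneIsMM_iff_sublinearDelay :
    Theses.OutsiderSandwich.BlockOneIsMM ↔
      ∀ ε : ℝ, 0 < ε → ∀ N₀ : ℕ, ∃ N : ℕ, N₀ ≤ N ∧ ∃ p : ℕ, Delayed N p ∧ (p : ℝ) ≤ ε * N := by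
  rw [blockOneIsMM_iff_forall_exponentAchieved]
  constructor
  · intro h ε hε N₀
    obtain ⟨N, hN, B, hB, hBle⟩ := h (ε / 2) (by positivity) (max N₀ ⌈2 / ε⌉₊)
    refine ⟨N, (le_max_left _ _).trans hN, ⌊ε / 2 * N⌋₊ + 1, delayed_of_helped hB ?_, ?_⟩
    · have h2 : (B : ℝ) ≤ (2 : ℝ) ^ (((⌊ε / 2 * N⌋₊ + 1 : ℕ)) : ℝ) :=
        hBle.trans (Real.rpow_le_rpow_of_exponent_le one_le_two
          (by exact_mod_cast (Nat.lt_floor_add_one (ε / 2 * N)).le))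
      rw [Real.rpow_natCast] at h2
      exact_mod_cast h2
    · have hN2 : ((⌈2 / ε⌉₊ : ℕ) : ℝ) ≤ N := by exact_mod_cast (le_max_right _ _).trans hN
      have h2 : 2 / ε ≤ N := (Nat.le_ceil _).trans hN2
      have hfl : (⌊ε / 2 * N⌋₊ : ℝ) ≤ ε / 2 * N := Nat.floor_le (by positivity)
      have h1 : 1 ≤ ε / 2 * N := by
        have h3 := mul_le_mul_of_nonneg_left h2 (half_pos hε).le
        rwa [show ε / 2 * (2 / ε) = 1 by field_simp] at h3
      push_cast
      linarith
  · intro h θ hθ N₀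
    obtain ⟨N, hN, p, hp, hple⟩ := h (θ / 3) (by positivity) N₀
    refine ⟨N, hN, 8 ^ p, helped_eight_pow_of_delayed hp, ?_⟩
    rw [cast_eight_pow]
    exact Real.rpow_le_rpow_of_exponent_le one_le_two (by push_cast; linarith)

/-- **`ω = 2 ⟹ sublinear delay.`** -/
theorem sublinearDelay_of_summit (hS : _root_.MatrixMultiplication) :
    ∀ ε : ℝ, 0 < ε → ∀ N₀ : ℕ, ∃ N : ℕ, N₀ ≤ N ∧ ∃ p : ℕ, Delayed N p ∧ (p : ℝ) ≤ ε * N :=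
  blockOneIsMM_iff_sublinearDelay.1
    (blockOneIsMM_iff_exchangeExponent_eq_zero.2 (exchangeExponent_eq_zero_of_summit hS))

/-- **A linear delay law refutes the leaf**: if some `c > 0` has `d(N) ≥ cN` for all large `N`,
then `¬ BlockOneIsMM` (hence `ω > 2`). -/
theorem not_blockOneIsMM_of_linear_delay {c : ℝ} (hc : 0 < c) {N₁ : ℕ}
    (h : ∀ N, N₁ ≤ N → c * N ≤ delayNumber N) : ¬ Theses.OutsiderSandwich.BlockOneIsMM := by
  rw [blockOneIsMM_iff_sublinearDelay]
  intro H
  obtain ⟨N, hN, p, hp, hple⟩ := H (c / 2) (half_pos hc) (max N₁ 1)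
  have hN1 : (1 : ℝ) ≤ N := by exact_mod_cast (le_max_right _ _).trans hN
  have hd : c * N ≤ delayNumber N := h N ((le_max_left _ _).trans hN)
  have hdp : (delayNumber N : ℝ) ≤ p := by exact_mod_cast delayNumber_le hp
  nlinarith

end Summit.MatrixMultiplication.MatrixMultiplication.Theorems.OutsiderSandwichDelayLadder
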